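import Literature.Analysis.FluidPDE.LerayHopfSuitableLocalEnergy
import Literature.Analysis.FluidPDE.SereginSverakPressureProofs

/-!
# Crux `SelfMixingDichotomy.SequentialTypeIExclusion` (stmt-NavierStokesRegularity-1424), line `registered` (r4):
  STUB `stub_lerayHopfLocalEnergySolution` — a classical Leray–Hopf solution on `[0, T)` is, with its gauged
  pressure, a local energy solution on `ℝ³ × (0, T)`

Helper file (`--supports stmt-NavierStokesRegularity-1424`) proving the registered stub
`stub_lerayHopfLocalEnergySolution` of the r4 skeleton (`Cruxes/SequentialTypeIExclusion/Lines/birth.lean`):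

> a classical solution `(u, p)` of Navier–Stokes (`ν = 1`, no force) on `ℝ³ × [0, T)` which is a Leray–Hopf weak
> solution on `[0, T]` with datum `u 0` is, together with the gauged pressure
> `q(t, x) = p(t, x) − (p(t, 0) − p̃[u(t)](0))`, a local energy solution on `ℝ³ × (0, T)` with datum `u 0` in the
> sense of Seregin 2014, Def. B.1 (`IsLocalEnergySolutionOn T 1 (u 0) u q`).

Proof (Seregin 2014, App. B Def. B.1 and §B.5; Lemarié-Rieusset 2016, §14.9 — "Leray–Hopf solutions which are
suitable on the strip are local energy solutions"; the clauses are checked exactly as in the tree's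
`IsGlobalLerayHopf.isLocalEnergySolutionOn_of_suitable_of_eqOn`, which uses of the global Leray–Hopf class only its
restriction `IsLerayHopfOn T`):

* (B.1.5)+(B.1.8) `(u, q)` is a suitable weak solution on the open strip `(0, T) × ℝ³`
  (`SereginSverak2002.isSuitableWeakSolutionOn_gauge_of_classical`);
* (B.1.4) `q ∈ L^{3/2}((0, T) × ℝ³)` (`SereginSverak2002.lintegral_slab_gauged_pressure_lt_top`), hence on
  `(0, T) × K`; the every-time unit-ball bound `∫_{B(x₀,1)} |u(t)|² ≤ ‖u(t)‖₂² ≤ ‖u(0)‖₂²` (energy inequality,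
  `SereginSverak2002.eEnergy_le`); the weak spatial gradient of the Leray–Hopf class with `∫₀ᵀ∫ |∇u|² < ∞`
  (`IsLerayHopfOn.exists_hasWeakSpatialGradientOn`);
* (B.1.6) weak continuity on the closed interval `[0, T]` from the Leray–Hopf weak continuity on `(0, T]` and the
  weak limit `u 0` at `0⁺` (`continuousOn_Icc_of_Ioc_of_tendsto`);
* (B.1.7) `∫_K |u(t) − u(0)|² ≤ ‖u(t) − u(0)‖₂² → 0` (`strong_initial`);
* Jia–Šverák's decay at spatial infinity: slices in `L²` decay (`tendsto_setLIntegral_ball_cocompact`) and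
  `tendsto_lintegral_prod_ball_cocompact_of_slices`.
-/

noncomputable section

-- the summit and its single problem share the name (D-0017 nested layout)
set_option linter.dupNamespace false

namespace Summit.NavierStokesRegularity.NavierStokesRegularity.Theorems.SequentialTypeIExclusion.Registered

open scoped ENNReal NNReal Topology InnerProductSpace RealInnerProductSpace
open Literature.Analysis.FluidPDE Set Filter MeasureTheory Function Metric

/-- **STUB `stub_lerayHopfLocalEnergySolution` (r4) — a classical Leray–Hopf solution is, with its gauged pressure,
a local energy solution on the strip** (Seregin 2014, App. B Def. B.1 and §B.5; Lemarié-Rieusset 2016, §14.9). For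
every `T > 0`, every classical solution `(u, p)` of Navier–Stokes (`ν = 1`, no force) on `ℝ³ × [0, T)` which is a
Leray–Hopf weak solution on `[0, T]` with datum `u 0` is, together with the gauged pressure
`q(t, x) = p(t, x) − (p(t, 0) − p̃[u(t)](0))`, a local energy solution on `ℝ³ × (0, T)` with datum `u 0`
(`IsLocalEnergySolutionOn T 1 (u 0) u q`). -/
theorem stub_lerayHopfLocalEnergySolution :
    ∀ T : ℝ, 0 < T →
      ∀ (u : ℝ → EuclideanSpace ℝ (Fin 3) → EuclideanSpace ℝ (Fin 3))
        (p : ℝ → EuclideanSpace ℝ (Fin 3) → ℝ),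
        Literature.Analysis.FluidPDE.IsClassicalNSSolutionOn (Set.Ico 0 T) 1 0 u p →
        Literature.Analysis.FluidPDE.IsLerayHopfOn T 1 0 (u 0) u →
        Literature.Analysis.FluidPDE.IsLocalEnergySolutionOn T 1 (u 0) u
          (fun t x => p t x - (p t 0 - Literature.Analysis.FluidPDE.normalisedPressure (u t) 0)) := by
  intro T hT u p hcl hLH
  -- the gauged pressure `q = p − (p(·, 0) − p̃[u](0))`
  set q : ℝ → EuclideanSpace ℝ (Fin 3) → ℝ :=
    fun t x => p t x - (p t 0 - normalisedPressure (u t) 0)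
  -- (B.1.5)+(B.1.8): `(u, q)` is a suitable weak solution on the open strip `(0, T) × ℝ³`
  have hsuit : IsSuitableWeakSolutionOn
      (slab (EuclideanSpace ℝ (Fin 3)) (Ioo 0 T) isOpen_Ioo) 1 0 u q :=
    SereginSverak2002.isSuitableWeakSolutionOn_gauge_of_classical one_pos hT hcl hLH _
      (coe_slab _ _).subset
  -- (B.1.4): `q ∈ L^{3/2}((0, T) × ℝ³)`, hence `q ∈ L^{3/2}((0, T) × K)` for every (compact) `K`
  have hqint : ∫⁻ w in Ioo 0 T ×ˢ (univ : Set (EuclideanSpace ℝ (Fin 3))),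
      ‖q w.1 w.2‖ₑ ^ (3 / 2 : ℝ) < ∞ :=
    SereginSverak2002.lintegral_slab_gauged_pressure_lt_top one_pos hT hcl hLH
  have hp : ∀ K : Set (EuclideanSpace ℝ (Fin 3)), IsCompact K →
      ∫⁻ z in Ioo 0 T ×ˢ K, ‖q z.1 z.2‖ₑ ^ (3 / 2 : ℝ) < ∞ := fun K _ =>
    lt_of_le_of_lt (lintegral_mono_set (Set.prod_mono Subset.rfl (subset_univ _))) hqint
  -- the every-time energy bound `∫ |u(t)|² ≤ 2 E(u 0)` of the Leray–Hopf class
  have henergy : ∀ t ∈ Icc 0 T,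
      eEnergy (u t) ≤ ENNReal.ofReal (2 * VectorCalculus.kineticEnergy (u 0)) := fun t ht =>
    SereginSverak2002.eEnergy_le zero_le_one hLH ht
  refine
    { suitable := hsuit
      pressure := hp
      sliceMeasurable := fun t ht => (hLH.memLp t ht).1
      uniformLocalEnergy := ?_
      uniformLocalGradient := ?_
      weakContinuous := ?_
      initial := ?_
      decay := ?_ }
  · -- (B.1.4): the every-time unit-ball bound
    refine ⟨(ENNReal.ofReal (2 * VectorCalculus.kineticEnergy (u 0))).toNNReal, fun t ht x₀ => ?_⟩
    rw [ENNReal.coe_toNNReal ENNReal.ofReal_ne_top]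
    exact (setLIntegral_le_lintegral _ _).trans (henergy t ht)
  · -- (B.1.4): the weak spatial gradient of the Leray–Hopf class and its unit-ball bound
    obtain ⟨G, hG, -, hGint, -⟩ := hLH.exists_hasWeakSpatialGradientOn
    refine ⟨G, hG, (∫⁻ z in Ioo 0 T ×ˢ (univ : Set (EuclideanSpace ℝ (Fin 3))),
      ENNReal.ofReal (frobeniusNormSq (G z.1 z.2))).toNNReal, fun x₀ => ?_⟩
    rw [ENNReal.coe_toNNReal hGint.ne]
    exact lintegral_mono_set (Set.prod_mono Subset.rfl (subset_univ _))
  · -- (B.1.6): weak continuity on the closed interval `[0, T]`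
    intro φ hφ
    have hφ2 : MemLp φ 2 volume :=
      hφ.contDiff.continuous.memLp_of_hasCompactSupport hφ.hasCompactSupport
    obtain ⟨hc, h0⟩ := hLH.weak_continuous φ hφ2
    exact continuousOn_Icc_of_Ioc_of_tendsto hc h0
  · -- (B.1.7): the datum is attained in `L²_loc` (indeed in `L²`)
    intro K hK
    have hlim : Tendsto (fun t => eLpNorm (u t - u 0) 2 volume ^ 2) (𝓝[>] (0 : ℝ)) (𝓝 0) := by
      have h := ENNReal.Tendsto.pow (n := 2) hLH.strong_initial
      simpa using h
    refine tendsto_of_tendsto_of_tendsto_of_le_of_le' tendsto_const_nhds hlim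
      (Eventually.of_forall fun _ => zero_le) ?_
    filter_upwards [self_mem_nhdsWithin] with t ht
    rw [← eEnergy_eq_eLpNorm_sq (u t - u 0)]
    exact setLIntegral_le_lintegral _ _
  · -- Jia–Šverák's decay at spatial infinity on the strip
    intro R hR
    have hmeas : AEStronglyMeasurable (uncurry u)
        (volume.restrict (Ioo (0 : ℝ) T ×ˢ (univ : Set (EuclideanSpace ℝ (Fin 3))))) :=
      hLH.weak.1
    have hC : ∀ s ∈ Ioo 0 T, ∀ x₀ : (EuclideanSpace ℝ (Fin 3)), ∫⁻ y in ball x₀ 1, ‖u s y‖ₑ ^ 2 ≤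
        (ENNReal.ofReal (2 * VectorCalculus.kineticEnergy (u 0))).toNNReal := by
      intro s hs x₀
      rw [ENNReal.coe_toNNReal ENNReal.ofReal_ne_top]
      exact (setLIntegral_le_lintegral _ _).trans (henergy s (Ioo_subset_Icc_self hs))
    have hdec : ∀ᵐ s ∂(volume.restrict (Ioo (0 : ℝ) T)),
        Tendsto (fun x₀ : (EuclideanSpace ℝ (Fin 3)) => ∫⁻ y in ball x₀ 1, ‖u s y‖ₑ ^ 2)
          (cocompact (EuclideanSpace ℝ (Fin 3))) (𝓝 0) := by
      refine (ae_restrict_mem measurableSet_Ioo).mono fun s hs => ?_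
      have hfin : ∫⁻ y, ‖u s y‖ₑ ^ 2 ≠ ∞ :=
        ((henergy s (Ioo_subset_Icc_self hs)).trans_lt ENNReal.ofReal_lt_top).ne
      exact tendsto_setLIntegral_ball_cocompact hfin 1
    exact tendsto_lintegral_prod_ball_cocompact_of_slices hmeas hC hdec R

end Summit.NavierStokesRegularity.NavierStokesRegularity.Theorems.SequentialTypeIExclusion.Registered

end
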